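import Summits.HodgeConjecture.CorCM.Census.QuaternionColumnCoincidence
import Summits.HodgeConjecture.CorCM.Census.BaseBlockCoveringOn

/-!
# The quaternion column, VI-b: the explicit `toward` faces of the covered blocks

COR-CM (cell `pub-hodgecm2`), count-neutral kernel combinatorics by the binder seat b09 (gen 39; lane QUATERNION COLUMN), part VI-b, on parts
I–VI-a (`Census/QuaternionColumn{Biarc,Circle,Chains,Potential,Family,Coincidence}.lean`) and the generic covering on a set
(`Census/BaseBlockCoveringOn.lean`: `toward_of_explicit`) used BY NAME.  Theorems only: no definition, no `decide`, no certificate, no named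
fact, no `sorry`.  HONEST FRAMING: `HC_CM` is NOT proved, here or anywhere in the tree; nothing here is a period or a headline.

**THEOREM (`toward_off`).**  Through every type of an explicitly covered block (`blkA ∪ blkB ∪ blkC` of part V) the lattice
`ℤ⟨pairs⟩ + ℤ⟨base changes of S⟩`, `S ⊇ qfam`, has a face toward a nearest base change: the far biarc blocks `BA_k` by the biarc face
`fplus (k−2) 0` read at its corner `barc (k−1) (−1)` toward `T₀` (near side, `2k ≤ n`, distance `k`) or by `fplus k 0` read at `barc k 0` toward
`barc (n−1) (−1) = T₀·(xa (−2))⁻¹` (far side, distance `n−k`), using the exact biarc potential of part IV; the coincidence blocks by the chain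
covers `c_i`, `c'_j` read at `C_i`, `C'_j` toward `T₀` (distance `2`, part VI-a) — the hypothesis `hoff` of `BaseBlock.toward_all_of_on`.

## References
* [Pohlmann1968] H. Pohlmann, Algebraic cycles on abelian varieties of complex multiplication type, Ann. of Math. 88 (1968), Thm 1.
-/

namespace Summit.HodgeConjecture.CorCM.Census.QuaternionColumn

open Finset QuaternionGroup
open Summit.HodgeConjecture.CorCM.Prior.AllgGroup.RfwfAllgGroup
open Summit.HodgeConjecture.CorCM.Census.BlockParity
open Summit.HodgeConjecture.CorCM.Census.Coinvariant
open Summit.HodgeConjecture.CorCM.Census.Nondegenerate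
open Summit.HodgeConjecture.CorCM.Census.BaseBlock
open Summit.HodgeConjecture.CorCM.Census.TwistGeneration

noncomputable section

variable {n : ℕ} [NeZero n]

/-! ## §3 The explicit `toward` faces of the covered blocks -/

/-- **A face read at its opposite corner**: `gface (Φ^{(t)(t')}) t t' = gface Φ t t'`. [folklore] -/
theorem gface_at_double (Φ : CMF (QuaternionGroup n) (c n)) (t t' : QuaternionGroup n) :
    gface (c n) c_mul_c (oflipCM (c n) c_mul_c t (oflipCM (c n) c_mul_c t' Φ)) t t' = gface (c n) c_mul_c Φ t t' := by
  have e1 : oflipCM (c n) c_mul_c t' (oflipCM (c n) c_mul_c t (oflipCM (c n) c_mul_c t' Φ)) = oflipCM (c n) c_mul_c t Φ := by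
    rw [oflipCM_oflipCM_comm (c n) c_mul_c t t' Φ, oflipCM_oflipCM_self]
  have e2 : oflipCM (c n) c_mul_c t (oflipCM (c n) c_mul_c t (oflipCM (c n) c_mul_c t' Φ)) = oflipCM (c n) c_mul_c t' Φ :=
    oflipCM_oflipCM_self _ _ _ _
  have e3 : oflipCM (c n) c_mul_c t (oflipCM (c n) c_mul_c t' (oflipCM (c n) c_mul_c t (oflipCM (c n) c_mul_c t' Φ))) = Φ := by
    rw [e1, oflipCM_oflipCM_self]
  rw [gface, gface, e3, e2, e1]
  abel

/-- A face only depends on the places, left slot. [folklore] -/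
theorem gface_cmul_left (Φ : CMF (QuaternionGroup n) (c n)) (t t' : QuaternionGroup n) :
    gface (c n) c_mul_c Φ (c n * t) t' = gface (c n) c_mul_c Φ t t' := by
  rw [gface, gface, oflipCM_cmul, oflipCM_cmul]

/-- A face only depends on the places, right slot. [folklore] -/
theorem gface_cmul_right (Φ : CMF (QuaternionGroup n) (c n)) (t t' : QuaternionGroup n) :
    gface (c n) c_mul_c Φ t (c n * t') = gface (c n) c_mul_c Φ t t' := by
  rw [gface, gface, oflipCM_cmul]

/-- Translates of a member of `S` lie in `ℤ⟨pairs⟩ + ℤ⟨base changes of S⟩`. [folklore] -/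
theorem mapDomain_mem_psp {S : Finset (CMF (QuaternionGroup n) (c n) →₀ ℤ)} {f : CMF (QuaternionGroup n) (c n) →₀ ℤ} (hf : f ∈ S)
    (Q : QuaternionGroup n) :
    Finsupp.mapDomain (rt (c n) Q) f ∈ Submodule.span ℤ (pairSet (c n)) ⊔ Submodule.span ℤ (translates (c n) S) :=
  Submodule.mem_sup_right (Submodule.subset_span ⟨Q, f, hf, rfl⟩)

/-- Arc distances at the base: `Δ(k, 0) = Δ(0, k) = k` (`k ≤ n`) and `Δ(0, −1) = Δ(−1, 0) = 1`. [folklore] -/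
theorem delta_base (k : ℕ) (hk : k ≤ n) :
    (arcZ ((k : ℕ) : ZMod (2 * n)) \ arcZ 0).card = k ∧ (arcZ (0 : ZMod (2 * n)) \ arcZ (k : ℕ)).card = k ∧
      (arcZ (0 : ZMod (2 * n)) \ arcZ (0 - 1)).card = 1 ∧ (arcZ ((0 : ZMod (2 * n)) - 1) \ arcZ 0).card = 1 := by
  have hn : 1 ≤ n := Nat.one_le_iff_ne_zero.mpr (NeZero.ne n)
  refine ⟨?_, ?_, ?_, ?_⟩
  · have h := delta_add_self (0 : ZMod (2 * n)) hk; rwa [zero_add] at h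
  · have h := delta_self_add (0 : ZMod (2 * n)) hk; rwa [zero_add] at h
  · have h := delta_add_self ((0 : ZMod (2 * n)) - 1) hn; rwa [Nat.cast_one, sub_add_cancel] at h
  · have h := delta_self_add ((0 : ZMod (2 * n)) - 1) hn; rwa [Nat.cast_one, sub_add_cancel] at h

/-- **`toward` through the far biarc blocks, near side** (`2 ≤ k`, `2k ≤ n`): the biarc face `fplus (k−2) 0`, read at its corner
`barc (k−1) (−1) = (barc k 0)·(a 1)⁻¹`, is toward `T₀` at distance `k = bpot`. [folklore] -/
theorem toward_blkA_near (S : Finset (CMF (QuaternionGroup n) (c n) →₀ ℤ)) (hS : qfam n ⊆ S) (k : ℕ) (hk2 : 2 ≤ k)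
    (hkn : 2 * k ≤ n) {Φ : CMF (QuaternionGroup n) (c n)} (hΦ : blk (c n) Φ = blk (c n) (barc (k : ZMod (2 * n)) 0)) :
    ∃ Q s s' : QuaternionGroup n, bpot (c n) (barc 0 0) Φ = ddist (rt (c n) Q (barc 0 0)) Φ ∧ s ∈ (rt (c n) Q (barc 0 0)).1 \ Φ.1 ∧
      s' ∈ (rt (c n) Q (barc 0 0)).1 \ Φ.1 ∧ s ≠ s' ∧
        gface (c n) c_mul_c Φ s s' ∈ Submodule.span ℤ (pairSet (c n)) ⊔ Submodule.span ℤ (translates (c n) S) := by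
  have hn := NeZero.ne n
  set K : ZMod (2 * n) := ((k : ℕ) : ZMod (2 * n)) with hK
  have hK2 : K - 2 = ((k - 2 : ℕ) : ZMod (2 * n)) := by rw [hK, Nat.cast_sub hk2, Nat.cast_two]
  have hK1 : K - 1 = ((k - 1 : ℕ) : ZMod (2 * n)) := by rw [hK, Nat.cast_sub (by omega), Nat.cast_one]
  have hΨ : rt (c n) (a 1) (barc K 0) = barc (K - 1) (0 - 1) := rt_a_barc 1 K 0
  have hface : gface (c n) c_mul_c (barc (K - 1) (0 - 1)) (a (K - 2)) (c n * xa (0 - 1)) = fplus (K - 2) 0 := by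
    rw [gface_cmul_right, fplus, ← gface_at_double (barc (K - 2) 0) (a (K - 2)) (xa (0 - 1)), oflipCM_xa_last_barc, oflipCM_a_barc,
      show K - 2 + 1 = K - 1 by ring]
  refine toward_of_explicit (c n) (barc 0 0) c_mul_c _ (Ψ := barc (K - 1) (0 - 1)) (Q₀ := 1) (t := a (K - 2)) (t' := c n * xa (0 - 1))
    ?_ ?_ ?_ (fun h => by rw [(c_mul_a _).2] at h; cases h) (fun Q => ?_) (by rw [hΦ, ← blk_rt (c n) (a 1) (barc K 0), hΨ])
  · rw [rt_one, ← hΨ, bpot_rt, hΨ, bpot_barc_of_le _ _ (by rw [(delta_base k (by omega)).1]; omega), (delta_base k (by omega)).1,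
      ddist_barc_barc, hK1, (delta_base (k - 1) (by omega)).2.1, (delta_base 0 (Nat.zero_le _)).2.2.1]
    omega
  · rw [rt_one, mem_sdiff, a_mem_barc, a_mem_barc, sub_zero, show K - 2 - (K - 1) = -1 by ring, val_neg_one, hK2,
      val_natCast_of_lt (by omega)]
    omega
  · rw [rt_one, (c_mul_a _).2, mem_sdiff, xa_mem_barc, xa_mem_barc, sub_zero,
      show (0 : ZMod (2 * n)) - 1 + (n : ZMod (2 * n)) - (0 - 1) = (n : ZMod (2 * n)) by ring, val_n,
      show (0 : ZMod (2 * n)) - 1 + (n : ZMod (2 * n)) = ((n - 1 : ℕ) : ZMod (2 * n)) by rw [Nat.cast_sub (by omega), Nat.cast_one]; ring,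
      val_natCast_of_lt (by omega)]
    omega
  · rw [hface, hK2]
    exact mapDomain_mem_psp (hS (fplus_mem_qfam (k - 2) (by omega))) Q

/-- **`toward` through the far biarc blocks, far side** (`n ≤ 2k`, `k ≤ n−2`): the biarc face `fplus k 0`, read at its corner `barc k 0`,
is toward the base change `barc (n−1) (−1) = T₀·(xa (−2))⁻¹` at distance `n − k = bpot`. [folklore] -/
theorem toward_blkA_far (S : Finset (CMF (QuaternionGroup n) (c n) →₀ ℤ)) (hS : qfam n ⊆ S) (k : ℕ) (hkn : n ≤ 2 * k)
    (hk2 : k + 2 ≤ n) {Φ : CMF (QuaternionGroup n) (c n)} (hΦ : blk (c n) Φ = blk (c n) (barc (k : ZMod (2 * n)) 0)) :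
    ∃ Q s s' : QuaternionGroup n, bpot (c n) (barc 0 0) Φ = ddist (rt (c n) Q (barc 0 0)) Φ ∧ s ∈ (rt (c n) Q (barc 0 0)).1 \ Φ.1 ∧
      s' ∈ (rt (c n) Q (barc 0 0)).1 \ Φ.1 ∧ s ≠ s' ∧
        gface (c n) c_mul_c Φ s s' ∈ Submodule.span ℤ (pairSet (c n)) ⊔ Submodule.span ℤ (translates (c n) S) := by
  have hn := NeZero.ne n
  set K : ZMod (2 * n) := ((k : ℕ) : ZMod (2 * n)) with hK
  have hT : rt (c n) (xa (0 - 1 - 1)) (barc (0 : ZMod (2 * n)) 0) = barc (K + ((n - 1 - k : ℕ) : ZMod (2 * n))) (0 - 1) := by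
    rw [rt_xa_barc, hK, Nat.cast_sub (by omega), Nat.cast_sub (by omega), Nat.cast_one]
    congr 1 <;> ring
  have hface : gface (c n) c_mul_c (barc K 0) (c n * a K) (xa (0 - 1)) = fplus K 0 := by rw [gface_cmul_left, fplus]
  have hΔ : bpot (c n) (barc 0 0) (barc K 0) + k = n := by
    have h := bpot_barc_of_ge K 0 (by rw [(delta_base k (by omega)).1]; exact hkn)
    rwa [(delta_base k (by omega)).1] at h
  refine toward_of_explicit (c n) (barc 0 0) c_mul_c _ (Ψ := barc K 0) (Q₀ := xa (0 - 1 - 1)) (t := c n * a K) (t' := xa (0 - 1))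
    ?_ ?_ ?_ (fun h => by rw [(c_mul_a _).1] at h; cases h) (fun Q => ?_) hΦ
  · rw [hT, ddist_barc_barc, delta_add_self K (by omega : n - 1 - k ≤ n), (delta_base 0 (Nat.zero_le _)).2.2.2]
    omega
  · rw [hT, (c_mul_a _).1, mem_sdiff, a_mem_barc, a_mem_barc, add_sub_cancel_left, val_n,
      show K + (n : ZMod (2 * n)) - (K + ((n - 1 - k : ℕ) : ZMod (2 * n))) = ((k + 1 : ℕ) : ZMod (2 * n)) by
        rw [Nat.cast_sub (by omega), Nat.cast_sub (by omega), hK]; push_cast; ring,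
      val_natCast_of_lt (by omega)]
    omega
  · rw [hT, mem_sdiff, xa_mem_barc, xa_mem_barc, sub_self, ZMod.val_zero, sub_zero,
      show (0 : ZMod (2 * n)) - 1 = -1 by ring, val_neg_one]
    omega
  · rw [hface]
    exact mapDomain_mem_psp (hS (fplus_mem_qfam k (by omega))) Q

/-- `a 0 ∈ T₀`, `a 0 ∉ C`, `t' ∈ T₀`, `t' ∉ C` for the coincidence type `C = T₀^{(a 0)(t')}` at a second place `t' ∈ T₀` off the place of `a 0`.
[folklore] -/
theorem corner_facts {t' : QuaternionGroup n} (ht' : t' ∈ (barc (0 : ZMod (2 * n)) 0).1) (h0 : (a 0 : QuaternionGroup n) ∉ orb (c n) t')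
    (h0' : t' ∉ orb (c n) (a (0 : ZMod (2 * n)))) :
    (a 0 : QuaternionGroup n) ∈ (barc (0 : ZMod (2 * n)) 0).1 \ (oflipCM (c n) c_mul_c (a 0) (oflipCM (c n) c_mul_c t' (barc 0 0))).1 ∧
      t' ∈ (barc (0 : ZMod (2 * n)) 0).1 \ (oflipCM (c n) c_mul_c (a 0) (oflipCM (c n) c_mul_c t' (barc 0 0))).1 := by
  have ha0 : (a 0 : QuaternionGroup n) ∈ (barc (0 : ZMod (2 * n)) 0).1 := by
    have h := (natCast_mem_base (n := n) (i := 0) (Nat.pos_of_ne_zero (NeZero.ne n))).1; rwa [Nat.cast_zero] at h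
  refine ⟨mem_sdiff.mpr ⟨ha0, ?_⟩, mem_sdiff.mpr ⟨ht', ?_⟩⟩
  · rw [mem_oflipCM_self, not_not, mem_oflipCM_of_notMem_orb h0]; exact ha0
  · rw [mem_oflipCM_of_notMem_orb h0', mem_oflipCM_self, not_not]; exact ht'

/-- **`toward` through the rotation coincidence blocks** `blk C_i` (`1 ≤ i ≤ n−2`, even `n`): the cover `c_i`, read at `C_i`, is toward `T₀`.
[folklore] -/
theorem toward_blkB (heven : Even n) (S : Finset (CMF (QuaternionGroup n) (c n) →₀ ℤ)) (hS : qfam n ⊆ S) (i : ℕ) (h1 : 1 ≤ i)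
    (h2 : i + 2 ≤ n) {Φ : CMF (QuaternionGroup n) (c n)}
    (hΦ : blk (c n) Φ = blk (c n) (oflipCM (c n) c_mul_c (a 0) (oflipCM (c n) c_mul_c (a ((i : ZMod (2 * n)) + 1)) (barc 0 0)))) :
    ∃ Q s s' : QuaternionGroup n, bpot (c n) (barc 0 0) Φ = ddist (rt (c n) Q (barc 0 0)) Φ ∧ s ∈ (rt (c n) Q (barc 0 0)).1 \ Φ.1 ∧
      s' ∈ (rt (c n) Q (barc 0 0)).1 \ Φ.1 ∧ s ≠ s' ∧
        gface (c n) c_mul_c Φ s s' ∈ Submodule.span ℤ (pairSet (c n)) ⊔ Submodule.span ℤ (translates (c n) S) := by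
  have hi1 : (a ((i : ZMod (2 * n)) + 1) : QuaternionGroup n) ∈ (barc (0 : ZMod (2 * n)) 0).1 := by
    rw [← Nat.cast_succ]; exact (natCast_mem_base (by omega)).1
  have h0 : (a 0 : QuaternionGroup n) ∉ orb (c n) (a ((i : ZMod (2 * n)) + 1)) := by
    refine a_notMem_orb_a ?_ ?_
    · rw [← Nat.cast_succ, ← Nat.cast_zero]; exact natCast_ne_of_lt (by omega) (by omega) (by omega)
    · rw [← Nat.cast_succ, ← Nat.cast_add, ← Nat.cast_zero]; exact natCast_ne_of_lt (by omega) (by omega) (by omega)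
  have h0' : (a ((i : ZMod (2 * n)) + 1) : QuaternionGroup n) ∉ orb (c n) (a (0 : ZMod (2 * n))) := by
    refine a_notMem_orb_a ?_ ?_
    · rw [← Nat.cast_succ, ← Nat.cast_zero]; exact natCast_ne_of_lt (by omega) (by omega) (by omega)
    · rw [← Nat.cast_succ, zero_add]; exact natCast_ne_of_lt (by omega) (by omega) (by omega)
  obtain ⟨h3, h4⟩ := corner_facts hi1 h0 h0'
  refine toward_of_explicit (c n) (barc 0 0) c_mul_c _ (Q₀ := 1) (t := a 0) (t' := a ((i : ZMod (2 * n)) + 1))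
    ?_ (by rw [rt_one]; exact h3) (by rw [rt_one]; exact h4) (fun h => ?_) (fun Q => ?_) hΦ
  · rw [rt_one, bpot_C heven i h1 h2, (ddist_C i h1 h2).1]
  · have h' := QuaternionGroup.a.inj h
    rw [← Nat.cast_succ, ← Nat.cast_zero] at h'
    exact natCast_ne_of_lt (n := n) (by omega) (by omega) (by omega) h'.symm
  · rw [gface_at_double]
    exact mapDomain_mem_psp (hS (c_mem_qfam i h1 h2)) Q

/-- **`toward` through the reflection coincidence blocks** `blk C'_j` (`1 ≤ j ≤ n−3`, even `n`). [folklore] -/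
theorem toward_blkC (heven : Even n) (S : Finset (CMF (QuaternionGroup n) (c n) →₀ ℤ)) (hS : qfam n ⊆ S) (j : ℕ) (h1 : 1 ≤ j)
    (h3 : j + 3 ≤ n) {Φ : CMF (QuaternionGroup n) (c n)}
    (hΦ : blk (c n) Φ = blk (c n) (oflipCM (c n) c_mul_c (a 0) (oflipCM (c n) c_mul_c (xa ((j : ZMod (2 * n)) + 1)) (barc 0 0)))) :
    ∃ Q s s' : QuaternionGroup n, bpot (c n) (barc 0 0) Φ = ddist (rt (c n) Q (barc 0 0)) Φ ∧ s ∈ (rt (c n) Q (barc 0 0)).1 \ Φ.1 ∧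
      s' ∈ (rt (c n) Q (barc 0 0)).1 \ Φ.1 ∧ s ≠ s' ∧
        gface (c n) c_mul_c Φ s s' ∈ Submodule.span ℤ (pairSet (c n)) ⊔ Submodule.span ℤ (translates (c n) S) := by
  have hj1 : (xa ((j : ZMod (2 * n)) + 1) : QuaternionGroup n) ∈ (barc (0 : ZMod (2 * n)) 0).1 := by
    rw [← Nat.cast_succ]; exact (natCast_mem_base (by omega)).2
  have h0' : (xa ((j : ZMod (2 * n)) + 1) : QuaternionGroup n) ∉ orb (c n) (a (0 : ZMod (2 * n))) := by
    rw [mem_orb, (c_mul_a _).1]; rintro (h | h) <;> cases h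
  obtain ⟨h3', h4⟩ := corner_facts hj1 (a_notMem_orb_xa _ _) h0'
  refine toward_of_explicit (c n) (barc 0 0) c_mul_c _ (Q₀ := 1) (t := a 0) (t' := xa ((j : ZMod (2 * n)) + 1))
    ?_ (by rw [rt_one]; exact h3') (by rw [rt_one]; exact h4) (fun h => by cases h) (fun Q => ?_) hΦ
  · rw [rt_one, bpot_C' heven j h1 h3, (ddist_C 1 le_rfl (by omega)).2 j (by omega)]
  · rw [gface_at_double]
    exact mapDomain_mem_psp (hS (c'_mem_qfam j h1 h3)) Q

/-- **THE `toward` PROPERTY OFF THE FAR SET**: through every type of potential `≥ 2` whose block is explicitly covered, the lattice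
`ℤ⟨pairs⟩ + ℤ⟨base changes of S⟩` (`S ⊇ qfam`) has a face toward a nearest base change (even `n ≥ 4`). [folklore] -/
theorem toward_off (heven : Even n) (h4 : 4 ≤ n) (S : Finset (CMF (QuaternionGroup n) (c n) →₀ ℤ)) (hS : qfam n ⊆ S)
    (Φ : CMF (QuaternionGroup n) (c n)) (hX : blk (c n) Φ ∈ blkA n ∪ blkB n ∪ blkC n) :
    ∃ Q s s' : QuaternionGroup n, bpot (c n) (barc 0 0) Φ = ddist (rt (c n) Q (barc 0 0)) Φ ∧ s ∈ (rt (c n) Q (barc 0 0)).1 \ Φ.1 ∧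
      s' ∈ (rt (c n) Q (barc 0 0)).1 \ Φ.1 ∧ s ≠ s' ∧
        gface (c n) c_mul_c Φ s s' ∈ Submodule.span ℤ (pairSet (c n)) ⊔ Submodule.span ℤ (translates (c n) S) := by
  rw [mem_union, mem_union] at hX
  rcases hX with (hX | hX) | hX
  · obtain ⟨k, hk, hkΦ⟩ := mem_image.mp hX
    rw [mem_Ico] at hk
    by_cases hkn : 2 * k ≤ n
    · exact toward_blkA_near S hS k hk.1 hkn hkΦ.symm
    · exact toward_blkA_far S hS k (by omega) (by omega) hkΦ.symm
  · obtain ⟨i, hi, hiΦ⟩ := mem_image.mp hX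
    rw [mem_Ico] at hi
    exact toward_blkB heven S hS i hi.1 (by omega) hiΦ.symm
  · obtain ⟨j, hj, hjΦ⟩ := mem_image.mp hX
    rw [mem_Ico] at hj
    exact toward_blkC heven S hS j hj.1 (by omega) hjΦ.symm

end

end Summit.HodgeConjecture.CorCM.Census.QuaternionColumn
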